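import Summits.QuantumFields.BalabanUV.Beta.FP.ExpLocalisedBubbleProduct

/-!
# `BalabanUV.Beta.FP.ExpLocalisedBubbleOrder2` — road «FP», N7 H-route, row H2-ASM-1 (engine, part 1): THE EXPONENTIALLY LOCALISED SMEAR
# `Σ'_{x,y} c(x,y)·F(z+x−y)` EXPANDED TO ORDER TWO at an abstract base point — symmetric second-moment form, third-difference remainder
# ([folklore] lattice bookkeeping; nothing of the manuscripts)

HONEST DEPENDENCY (page 1, mandatory): continuum YM on T⁴ ⇐ BetaPertH ∧ nine spine estimates (0/9 proved); BetaPertH ⇐ (D1) ∧ (D4) ∧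
CAP+tail; G-an2-4 gates asym, D1 and NE2/3/4.  HONEST FRAMING (cell contract, verbatim): «discharging `BetaPertH` makes Bałaban's UV
stability UNCONDITIONAL — a real constructive-QFT result; it is NOT the continuum limit and NOT the Clay problem.»  THIS MODULE is elementary [folklore] real
analysis on `ℤ^D`: the engine `FP/ExpLocalisedBubble` (orders zero and one, leaf-02 g6) ONE TAYLOR ORDER UP, over `FP/LatticeTaylorPath.abs_taylor2D_le` (g5).  Every
analytic input (decay of `F` and of its differences up to order THREE, the localisation of `c`) is a HYPOTHESIS displayed in the signatures; it cites nothing, defines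
nothing, mints no `Prop` fact, 0 sorry.  NOT the bubble of the perfect theory, NOT `hgerm`, NOT `hasym`, NOT D1, NOT BetaPertH, NOT continuum, NOT Clay.

ROW (road FP owner d1-p3-g6, `H2V-DESIGN.md` f78878bd5f8d2d18 §4 H2-ASM-1, R-FP-23 (c) first refusal of this lineage): the DOUBLE smear of the one-loop bubble needs the
single smear to order two (the `(2,0)`∕`(0,2)` placements are the same order `‖z‖⁻⁶` as `(1,1)`).  THIS FILE = the single-smear engine at order two, abstract base point;
the point of `ℤ⁴` and the marginal∕product weights are `FP/ExpLocalisedBubbleOrder2Point`, the double smear is `FP/ExpLocalisedBubbleMixed`.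

CONTENT (`e_i := Pi.single i 1`, `Δ_i := Δ_[e_i]`, `Θ_m := 2^{m+1}·(m!e^{δ/2}(2/δ)^m)·e^{δ/2}·Zl D (δ/2)²` the two-point letters of the engine).
* §0 `fwdDiff_comm` (lattice differences commute); `sum_sum_trunc_eq` ∕ `sum_sum_symm_eq` (finite-sum bookkeeping) ⟹ `newton2_eq_symm`, **`abs_taylor2D_symm_le`**: the
  discrete Taylor polynomial of order two of `abs_taylor2D_le` (Newton form `s_k(s_k−1)/2`, mixed term over `i < k`) REWRITTEN in the SYMMETRIC form
  `Σ_i s_i·Δ_iF − ½Σ_i s_i·Δ_iΔ_iF + ½Σ_{i,j} s_i s_j·Δ_iΔ_jF` (same third-difference remainder `D(D+1)²R³B`; the `−½Δ_iΔ_i` in the linear slot is the honest lattice centring).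
* §1 `abs_taylor2_le_near_far_pow` (order two, general far exponent `k`: near `D(D+1)²·B·|s|₁³`, far `(2A₀ + A₁|s|₁ + A₂|s|₁²)·(|s|₁/ρ)^k`); `summable_secondMoment`;
  **`abs_smear_sub_order2_le`**: at an abstract base point `z`,
  `|Σ' c·F(z+x−y) − (Σ'c)·F z − Σ_i m_i·(Δ_iF z − ½Δ_iΔ_iF z) − ½Σ_{i,j} M_{ij}·Δ_iΔ_jF z| ≤ C·(D(D+1)²·B·Θ₃ + (2A₀Θ_k + A₁Θ_{k+1} + A₂Θ_{k+2})/ρ^k)`,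
  `m_i := Σ' c p·(p.1−p.2)_i`, `M_{ij} := Σ' c p·(p.1−p.2)_i(p.1−p.2)_j`, every family's summability PROVED.
Unit `b2b-balaban-beta-d1-formalise-leaf-02` (gen 8).
-/

noncomputable section

namespace Summit.QuantumFields.BalabanUV.Beta.FP.ExpLocalisedBubbleOrder2

open Finset Filter Topology fwdDiff
open scoped BigOperators
open Literature.MathematicalPhysics.QuantumFieldTheory.Balaban1983to89
open Literature.MathematicalPhysics.QuantumFieldTheory.Balaban1983to89.Beta
open B12Sec2to5 (l1 l1_nonneg abs_coord_le_l1)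
open ExpKernelCalculus (Site Zl Zl_pos)
open Summit.QuantumFields.BalabanUV.Beta.FP.StencilMoments (summable_of_weight_exp)
open Summit.QuantumFields.BalabanUV.Beta.FP.LatticeTaylorPath (trunc trunc_apply abs_taylor2D_le)
open Summit.QuantumFields.BalabanUV.Beta.FP.HorizontalBookkeepingTail (l1_eq_natCast abs_apply_le_sum_natAbs hasSum_mul supNorm_le_add_of_box)
open Summit.QuantumFields.BalabanUV.Beta.FP.ExpLocalisedBubble
open Summit.QuantumFields.BalabanUV.Beta.FP.ExpLocalisedBubblePoint
open Summit.QuantumFields.BalabanUV.Beta.FP.ExpLocalisedBubbleProduct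
open DyadicShell (Pt supNorm supNorm_eq_zero_iff)

variable {D : ℕ}

/-! ## §0 Differences commute; the symmetric form of the order-two discrete Taylor polynomial -/

/-- [folklore] Lattice forward differences commute: `Δ_v Δ_w = Δ_w Δ_v`. -/
theorem fwdDiff_comm (v w : Site D) (f : Site D → ℝ) : Δ_[v] (Δ_[w] f) = Δ_[w] (Δ_[v] f) := by
  funext x
  simp only [fwdDiff]
  rw [add_right_comm x v w]
  ring

/-- [folklore] The mixed Newton term: `Σ_k Σ_i s_k·(trunc k s)_i·T k i = Σ_k Σ_i [i < k]·s_k s_i·T k i`. -/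
theorem sum_sum_trunc_eq (s : Site D) (T : Fin D → Fin D → ℝ) :
    ∑ k : Fin D, ∑ i : Fin D, (s k : ℝ) * (trunc k s i : ℝ) * T k i
      = ∑ k : Fin D, ∑ i : Fin D, (if (i : ℕ) < (k : ℕ) then (s k : ℝ) * (s i : ℝ) * T k i else 0) := by
  refine Finset.sum_congr rfl fun k _ => Finset.sum_congr rfl fun i _ => ?_
  simp only [trunc_apply]
  split_ifs with h
  · rfl
  · simp

/-- [folklore] For a SYMMETRIC array `U k i = U i k`: `Σ_k Σ_i U k i = 2·Σ_k Σ_i [i < k]·U k i + Σ_k U k k`. -/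
theorem sum_sum_symm_eq (U : Fin D → Fin D → ℝ) (hU : ∀ k i, U k i = U i k) :
    ∑ k : Fin D, ∑ i : Fin D, U k i
      = 2 * (∑ k : Fin D, ∑ i : Fin D, (if (i : ℕ) < (k : ℕ) then U k i else 0)) + ∑ k : Fin D, U k k := by
  have hsplit : ∀ k i : Fin D, U k i = (if (i : ℕ) < (k : ℕ) then U k i else 0) + ((if i = k then U k i else 0)
      + (if (k : ℕ) < (i : ℕ) then U k i else 0)) := by
    intro k i
    by_cases h1 : (i : ℕ) < (k : ℕ)
    · have h2 : i ≠ k := fun h => by rw [h] at h1; exact lt_irrefl _ h1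
      have h3 : ¬ (k : ℕ) < (i : ℕ) := fun h => lt_asymm h1 h
      simp [h1, h2, h3]
    · by_cases h2 : i = k
      · subst h2; simp
      · have h3 : (k : ℕ) < (i : ℕ) := by
          rcases lt_trichotomy (i : ℕ) (k : ℕ) with h | h | h
          · exact absurd h h1
          · exact absurd (Fin.ext h) h2
          · exact h
        simp [h1, h2, h3]
  have e1 : ∑ k : Fin D, ∑ i : Fin D, U k i
      = ∑ k : Fin D, ∑ i : Fin D, (if (i : ℕ) < (k : ℕ) then U k i else 0)
        + (∑ k : Fin D, ∑ i : Fin D, (if i = k then U k i else 0)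
          + ∑ k : Fin D, ∑ i : Fin D, (if (k : ℕ) < (i : ℕ) then U k i else 0)) := by
    rw [← Finset.sum_add_distrib, ← Finset.sum_add_distrib]
    refine Finset.sum_congr rfl fun k _ => ?_
    rw [← Finset.sum_add_distrib, ← Finset.sum_add_distrib]
    exact Finset.sum_congr rfl fun i _ => hsplit k i
  have e2 : ∑ k : Fin D, ∑ i : Fin D, (if i = k then U k i else 0) = ∑ k : Fin D, U k k := by
    refine Finset.sum_congr rfl fun k _ => ?_
    rw [Finset.sum_ite_eq' Finset.univ k (fun i => U k i)]
    simp
  have e3 : ∑ k : Fin D, ∑ i : Fin D, (if (k : ℕ) < (i : ℕ) then U k i else 0)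
      = ∑ k : Fin D, ∑ i : Fin D, (if (i : ℕ) < (k : ℕ) then U k i else 0) := by
    rw [Finset.sum_comm]
    refine Finset.sum_congr rfl fun k _ => Finset.sum_congr rfl fun i _ => ?_
    split_ifs with h
    · exact hU i k
    · rfl
  rw [e1, e2, e3]
  ring

/-- **THE SYMMETRIC FORM OF THE ORDER-TWO NEWTON POLYNOMIAL**: for `f : ℤ^D → ℝ`, base `p`, displacement `s`,
`Σ_k (s_k(s_k−1)/2)·Δ_kΔ_k f p + Σ_k Σ_i s_k·(trunc k s)_i·Δ_iΔ_k f p = ½·Σ_i Σ_j s_i s_j·Δ_iΔ_j f p − ½·Σ_i s_i·Δ_iΔ_i f p` (differences commute). [folklore] -/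
theorem newton2_eq_symm (f : Site D → ℝ) (p s : Site D) :
    ∑ k : Fin D, ((s k : ℝ) * ((s k : ℝ) - 1) / 2) * Δ_[(Pi.single k 1 : Site D)] (Δ_[(Pi.single k 1 : Site D)] f) p
      + ∑ k : Fin D, ∑ i : Fin D, (s k : ℝ) * (trunc k s i : ℝ) * Δ_[(Pi.single i 1 : Site D)] (Δ_[(Pi.single k 1 : Site D)] f) p
    = (1 / 2) * ∑ i : Fin D, ∑ j : Fin D, (s i : ℝ) * (s j : ℝ) * Δ_[(Pi.single i 1 : Site D)] (Δ_[(Pi.single j 1 : Site D)] f) p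
      - (1 / 2) * ∑ i : Fin D, (s i : ℝ) * Δ_[(Pi.single i 1 : Site D)] (Δ_[(Pi.single i 1 : Site D)] f) p := by
  set U : Fin D → Fin D → ℝ := fun k i => (s k : ℝ) * (s i : ℝ) * Δ_[(Pi.single i 1 : Site D)] (Δ_[(Pi.single k 1 : Site D)] f) p with hU
  have hUs : ∀ k i, U k i = U i k := by
    intro k i
    simp only [hU]
    rw [fwdDiff_comm (Pi.single i 1) (Pi.single k 1) f]
    ring
  have hmix := sum_sum_trunc_eq s (fun k i => Δ_[(Pi.single i 1 : Site D)] (Δ_[(Pi.single k 1 : Site D)] f) p)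
  have hsym := sum_sum_symm_eq U hUs
  -- the double sum in the statement, in the `U k i` orientation
  have e1 : ∑ i : Fin D, ∑ j : Fin D, (s i : ℝ) * (s j : ℝ) * Δ_[(Pi.single i 1 : Site D)] (Δ_[(Pi.single j 1 : Site D)] f) p
      = ∑ k : Fin D, ∑ i : Fin D, U k i := by
    rw [Finset.sum_comm]
    refine Finset.sum_congr rfl fun k _ => Finset.sum_congr rfl fun i _ => ?_
    simp only [hU]; ring
  have e2 : ∑ k : Fin D, ((s k : ℝ) * ((s k : ℝ) - 1) / 2) * Δ_[(Pi.single k 1 : Site D)] (Δ_[(Pi.single k 1 : Site D)] f) p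
      = (1 / 2) * ∑ k : Fin D, U k k - (1 / 2) * ∑ k : Fin D, (s k : ℝ) * Δ_[(Pi.single k 1 : Site D)] (Δ_[(Pi.single k 1 : Site D)] f) p := by
    rw [Finset.mul_sum, Finset.mul_sum, ← Finset.sum_sub_distrib]
    refine Finset.sum_congr rfl fun k _ => ?_
    simp only [hU]; ring
  have e3 : ∑ k : Fin D, ∑ i : Fin D, (s k : ℝ) * (trunc k s i : ℝ) * Δ_[(Pi.single i 1 : Site D)] (Δ_[(Pi.single k 1 : Site D)] f) p
      = ∑ k : Fin D, ∑ i : Fin D, (if (i : ℕ) < (k : ℕ) then U k i else 0) := by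
    rw [hmix]
  rw [e1, e2, e3, hsym]
  ring

/-- **SECOND-ORDER TAYLOR BOUND ON `ℤ^D`, SYMMETRIC FORM**: if every third difference `Δ_iΔ_jΔ_l f` is bounded by `B` on the coordinate box of radius `R` around `p`
and `|s_i| ≤ R`, then `|f (p+s) − f p − Σ_i s_i·Δ_i f p + ½Σ_i s_i·Δ_iΔ_i f p − ½Σ_i Σ_j s_i s_j·Δ_iΔ_j f p| ≤ D(D+1)²·R³·B`. [folklore] -/
theorem abs_taylor2D_symm_le (f : Site D → ℝ) (p s : Site D) {R : ℕ} (hs : ∀ i, |s i| ≤ (R : ℤ)) {B : ℝ} (hB : 0 ≤ B)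
    (h : ∀ x : Site D, (∀ i, |x i - p i| ≤ (R : ℤ)) → ∀ i j k : Fin D,
      |Δ_[(Pi.single i 1 : Site D)] (Δ_[(Pi.single j 1 : Site D)] (Δ_[(Pi.single k 1 : Site D)] f)) x| ≤ B) :
    |f (p + s) - f p - ∑ i : Fin D, (s i : ℝ) * Δ_[(Pi.single i 1 : Site D)] f p
        + (1 / 2) * ∑ i : Fin D, (s i : ℝ) * Δ_[(Pi.single i 1 : Site D)] (Δ_[(Pi.single i 1 : Site D)] f) p
        - (1 / 2) * ∑ i : Fin D, ∑ j : Fin D, (s i : ℝ) * (s j : ℝ) * Δ_[(Pi.single i 1 : Site D)] (Δ_[(Pi.single j 1 : Site D)] f) p|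
      ≤ (D : ℝ) * ((D : ℝ) + 1) ^ 2 * (R : ℝ) ^ 3 * B := by
  have h2 := abs_taylor2D_le f p s hs hB h
  have e := newton2_eq_symm f p s
  have key : f (p + s) - f p - ∑ i : Fin D, (s i : ℝ) * Δ_[(Pi.single i 1 : Site D)] f p
        + (1 / 2) * ∑ i : Fin D, (s i : ℝ) * Δ_[(Pi.single i 1 : Site D)] (Δ_[(Pi.single i 1 : Site D)] f) p
        - (1 / 2) * ∑ i : Fin D, ∑ j : Fin D, (s i : ℝ) * (s j : ℝ) * Δ_[(Pi.single i 1 : Site D)] (Δ_[(Pi.single j 1 : Site D)] f) p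
      = f (p + s) - f p - ∑ k : Fin D, (s k : ℝ) * Δ_[(Pi.single k 1 : Site D)] f p
        - ∑ k : Fin D, ((s k : ℝ) * ((s k : ℝ) - 1) / 2) * Δ_[(Pi.single k 1 : Site D)] (Δ_[(Pi.single k 1 : Site D)] f) p
        - ∑ k : Fin D, ∑ i : Fin D, (s k : ℝ) * (trunc k s i : ℝ) * Δ_[(Pi.single i 1 : Site D)] (Δ_[(Pi.single k 1 : Site D)] f) p := by
    linarith
  rw [key]
  exact h2

/-! ## §1 Order two at an abstract base point: near/far bound, second moments, the smear -/

/-- [folklore] `|Σ_i Σ_j s_i s_j·g_ij| ≤ A₂·|s|₁²` when every `|g_ij| ≤ A₂`. -/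
theorem abs_sum_sum_mul_le_l1_sq {s : Site D} {g : Fin D → Fin D → ℝ} {A₂ : ℝ} (hg : ∀ i j, |g i j| ≤ A₂) :
    |∑ i, ∑ j, (s i : ℝ) * (s j : ℝ) * g i j| ≤ A₂ * l1 s ^ 2 := by
  have e : A₂ * l1 s ^ 2 = ∑ i : Fin D, ∑ j : Fin D, |(s i : ℝ)| * |(s j : ℝ)| * A₂ := by
    unfold l1
    rw [sq, Finset.sum_mul_sum, Finset.mul_sum]
    refine Finset.sum_congr rfl fun i _ => ?_
    rw [Finset.mul_sum]
    exact Finset.sum_congr rfl fun j _ => by ring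
  rw [e]
  refine (Finset.abs_sum_le_sum_abs _ _).trans (Finset.sum_le_sum fun i _ => ?_)
  refine (Finset.abs_sum_le_sum_abs _ _).trans (Finset.sum_le_sum fun j _ => ?_)
  rw [abs_mul, abs_mul]
  exact mul_le_mul_of_nonneg_left (hg i j) (by positivity)

/-- [folklore] On the integer lattice `|s|₁ ≤ |s|₁²` (an integer `n ≥ 0` satisfies `n ≤ n²`). -/
theorem l1_le_l1_sq (s : Site D) : l1 s ≤ l1 s ^ 2 := by
  rw [l1_eq_natCast]
  have : ((∑ i, (s i).natAbs : ℕ) : ℝ) ≤ ((∑ i, (s i).natAbs : ℕ) : ℝ) ^ 2 := by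
    rcases Nat.eq_zero_or_pos (∑ i, (s i).natAbs) with h | h
    · rw [h]; simp
    · have h1 : (1 : ℝ) ≤ ((∑ i, (s i).natAbs : ℕ) : ℝ) := by exact_mod_cast h
      nlinarith
  exact this

/-- **ORDER TWO, GENERAL FAR EXPONENT**: `|F| ≤ A₀` everywhere, `|Δ_iF y| ≤ A₁`, `|Δ_iΔ_jF y| ≤ A₂` at the base point, third differences `≤ B` on the coordinate box of
radius `ρ ≥ 1` around `y` ⟹ for every `s` and every `k`,
`|F(y+s) − F y − Σ_i s_i·Δ_iF y + ½Σ_i s_i·Δ_iΔ_iF y − ½Σ_{i,j} s_i s_j·Δ_iΔ_jF y| ≤ D(D+1)²·B·|s|₁³ + (2A₀ + A₁|s|₁ + A₂|s|₁²)·(|s|₁/ρ)^k`. [folklore] -/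
theorem abs_taylor2_le_near_far_pow {F : Site D → ℝ} {y : Site D} {A₀ A₁ A₂ B : ℝ} {ρ : ℕ} (hρ : 0 < ρ) (hB : 0 ≤ B) (hA1nn : 0 ≤ A₁)
    (hA2nn : 0 ≤ A₂) (k : ℕ) (hA : ∀ t, |F t| ≤ A₀) (hA1 : ∀ i, |Δ_[(Pi.single i 1 : Site D)] F y| ≤ A₁)
    (hA2 : ∀ i j, |Δ_[(Pi.single i 1 : Site D)] (Δ_[(Pi.single j 1 : Site D)] F) y| ≤ A₂)
    (hF3 : ∀ t : Site D, (∀ i, |t i - y i| ≤ (ρ : ℤ)) → ∀ i j l,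
      |Δ_[(Pi.single i 1 : Site D)] (Δ_[(Pi.single j 1 : Site D)] (Δ_[(Pi.single l 1 : Site D)] F)) t| ≤ B) (s : Site D) :
    |F (y + s) - F y - ∑ i, (s i : ℝ) * Δ_[(Pi.single i 1 : Site D)] F y
        + (1 / 2) * ∑ i, (s i : ℝ) * Δ_[(Pi.single i 1 : Site D)] (Δ_[(Pi.single i 1 : Site D)] F) y
        - (1 / 2) * ∑ i, ∑ j, (s i : ℝ) * (s j : ℝ) * Δ_[(Pi.single i 1 : Site D)] (Δ_[(Pi.single j 1 : Site D)] F) y|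
      ≤ (D : ℝ) * ((D : ℝ) + 1) ^ 2 * B * l1 s ^ 3 + (2 * A₀ + A₁ * l1 s + A₂ * l1 s ^ 2) * (l1 s / ρ) ^ k := by
  have hA0 : 0 ≤ A₀ := (abs_nonneg _).trans (hA y)
  have hl1 := l1_nonneg s
  have hρ' : (0 : ℝ) < ρ := by exact_mod_cast hρ
  have hRl1 : ((∑ i, (s i).natAbs : ℕ) : ℝ) = l1 s := (l1_eq_natCast s).symm
  have hfar0 : 0 ≤ (2 * A₀ + A₁ * l1 s + A₂ * l1 s ^ 2) * (l1 s / ρ) ^ k := by positivity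
  by_cases hle : (∑ i, (s i).natAbs) ≤ ρ
  · have h := abs_taylor2D_symm_le F y s (abs_apply_le_sum_natAbs s) hB (fun x hx i j l =>
      hF3 x (fun j' => (hx j').trans (by exact_mod_cast hle)) i j l)
    rw [hRl1] at h
    calc _ ≤ (D : ℝ) * ((D : ℝ) + 1) ^ 2 * l1 s ^ 3 * B := h
      _ = (D : ℝ) * ((D : ℝ) + 1) ^ 2 * B * l1 s ^ 3 := by ring
      _ ≤ _ := le_add_of_nonneg_right hfar0
  · have h2 : (1 : ℝ) ≤ l1 s / ρ := by
      rw [le_div_iff₀ hρ', one_mul, ← hRl1]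
      exact_mod_cast (not_le.mp hle).le
    have hs1 : |∑ i, (s i : ℝ) * Δ_[(Pi.single i 1 : Site D)] F y| ≤ A₁ * l1 s := abs_sum_mul_le_l1 hA1
    have hs2 : |∑ i, (s i : ℝ) * Δ_[(Pi.single i 1 : Site D)] (Δ_[(Pi.single i 1 : Site D)] F) y| ≤ A₂ * l1 s :=
      abs_sum_mul_le_l1 (fun i => hA2 i i)
    have hs3 : |∑ i, ∑ j, (s i : ℝ) * (s j : ℝ) * Δ_[(Pi.single i 1 : Site D)] (Δ_[(Pi.single j 1 : Site D)] F) y| ≤ A₂ * l1 s ^ 2 :=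
      abs_sum_sum_mul_le_l1_sq hA2
    have hsq := l1_le_l1_sq s
    have h1 : |F (y + s) - F y - ∑ i, (s i : ℝ) * Δ_[(Pi.single i 1 : Site D)] F y
        + (1 / 2) * ∑ i, (s i : ℝ) * Δ_[(Pi.single i 1 : Site D)] (Δ_[(Pi.single i 1 : Site D)] F) y
        - (1 / 2) * ∑ i, ∑ j, (s i : ℝ) * (s j : ℝ) * Δ_[(Pi.single i 1 : Site D)] (Δ_[(Pi.single j 1 : Site D)] F) y|
        ≤ 2 * A₀ + A₁ * l1 s + A₂ * l1 s ^ 2 := by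
      have t1 := hA (y + s); have t2 := hA y
      rw [abs_le] at t1 t2 hs1 hs2 hs3 ⊢
      constructor <;> nlinarith [t1.1, t1.2, t2.1, t2.2, hs1.1, hs1.2, hs2.1, hs2.2, hs3.1, hs3.2, hsq, hA2nn]
    have hnn : 0 ≤ 2 * A₀ + A₁ * l1 s + A₂ * l1 s ^ 2 := by positivity
    calc _ ≤ 2 * A₀ + A₁ * l1 s + A₂ * l1 s ^ 2 := h1
      _ ≤ (2 * A₀ + A₁ * l1 s + A₂ * l1 s ^ 2) * (l1 s / ρ) ^ k := le_mul_of_one_le_right hnn (one_le_pow₀ h2)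
      _ ≤ _ := le_add_of_nonneg_left (by positivity)

section Smear

variable {c : Site D × Site D → ℝ} {F : Site D → ℝ} {C δ A₀ : ℝ}

/-- [folklore] `|(x−y)_i (x−y)_j| ≤ ((|x|₁+1) + (|y|₁+1))²`. -/
theorem abs_coord_mul_coord_le (x y : Site D) (i j : Fin D) :
    |(((x - y) i : ℤ) : ℝ) * (((x - y) j : ℤ) : ℝ)| ≤ ((l1 x + 1) + (l1 y + 1)) ^ 2 := by
  rw [abs_mul, sq]
  have hL := l1_sub_le_letters x y
  have hi := (abs_coord_le_l1 (x - y) i).trans hL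
  have hj := (abs_coord_le_l1 (x - y) j).trans hL
  exact mul_le_mul hi hj (abs_nonneg _) (by linarith [l1_nonneg x, l1_nonneg y])

/-- [folklore] The second-moment families `p ↦ c p·(p.1−p.2)_i·(p.1−p.2)_j` are summable. -/
theorem summable_secondMoment (hδ : 0 < δ) (hc : ∀ p : Site D × Site D, |c p| ≤ C * (Real.exp (-δ * l1 p.1) * Real.exp (-δ * l1 p.2)))
    (i j : Fin D) : Summable fun p : Site D × Site D => c p * ((((p.1 - p.2) i : ℤ) : ℝ) * (((p.1 - p.2) j : ℤ) : ℝ)) := by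
  have h := summable_loc_mul_pow hδ hc 2
  refine Summable.of_norm_bounded h (fun p => ?_)
  rw [Real.norm_eq_abs, abs_mul]
  exact mul_le_mul_of_nonneg_left (abs_coord_mul_coord_le p.1 p.2 i j) (abs_nonneg _)

/-- **ORDER TWO AT AN ABSTRACT BASE POINT**: `|c| ≤ C·e^{−δ(|x|₁+|y|₁)}`, `|F| ≤ A₀`, `|Δ_iF z| ≤ A₁`, `|Δ_iΔ_jF z| ≤ A₂` (`A₁, A₂ ≥ 0`), third differences
of `F` bounded by `B` on the coordinate box of radius `ρ ≥ 1` around `z` ⟹ with the FIRST MOMENTS `m_i := Σ' c p·(p.1−p.2)_i` and the SECOND MOMENTS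
`M_{ij} := Σ' c p·(p.1−p.2)_i(p.1−p.2)_j`, for every `k`,
`|Σ' c p·F(z+p.1−p.2) − (Σ'c)·F z − Σ_i m_i·(Δ_iF z − ½Δ_iΔ_iF z) − ½Σ_{i,j} M_{ij}·Δ_iΔ_jF z| ≤ C·(D(D+1)²·B·Θ₃ + (2A₀Θ_k + A₁Θ_{k+1} + A₂Θ_{k+2})/ρ^k)`.
[folklore] -/
theorem abs_smear_sub_order2_le (hδ : 0 < δ) (hc : ∀ p : Site D × Site D, |c p| ≤ C * (Real.exp (-δ * l1 p.1) * Real.exp (-δ * l1 p.2)))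
    (hA : ∀ t, |F t| ≤ A₀) {z : Site D} {A₁ A₂ B : ℝ} {ρ : ℕ} (hρ : 0 < ρ) (hB : 0 ≤ B) (hA1nn : 0 ≤ A₁) (hA2nn : 0 ≤ A₂) (k : ℕ)
    (hA1 : ∀ i, |Δ_[(Pi.single i 1 : Site D)] F z| ≤ A₁)
    (hA2 : ∀ i j, |Δ_[(Pi.single i 1 : Site D)] (Δ_[(Pi.single j 1 : Site D)] F) z| ≤ A₂)
    (hF3 : ∀ t : Site D, (∀ i, |t i - z i| ≤ (ρ : ℤ)) → ∀ i j l,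
      |Δ_[(Pi.single i 1 : Site D)] (Δ_[(Pi.single j 1 : Site D)] (Δ_[(Pi.single l 1 : Site D)] F)) t| ≤ B) :
    |∑' p : Site D × Site D, c p * F (z + p.1 - p.2) - (∑' p : Site D × Site D, c p) * F z
        - ∑ i, (∑' p : Site D × Site D, c p * ((p.1 - p.2) i : ℝ))
            * (Δ_[(Pi.single i 1 : Site D)] F z - (1 / 2) * Δ_[(Pi.single i 1 : Site D)] (Δ_[(Pi.single i 1 : Site D)] F) z)
        - (1 / 2) * ∑ i, ∑ j, (∑' p : Site D × Site D, c p * ((((p.1 - p.2) i : ℤ) : ℝ) * (((p.1 - p.2) j : ℤ) : ℝ)))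
            * Δ_[(Pi.single i 1 : Site D)] (Δ_[(Pi.single j 1 : Site D)] F) z|
      ≤ C * ((D : ℝ) * ((D : ℝ) + 1) ^ 2 * B * (2 ^ (3 + 1) * (((3 : ℕ).factorial : ℝ) * Real.exp (δ / 2) * (2 / δ) ^ 3) * Real.exp (δ / 2) * Zl D (δ / 2) ^ 2)
          + (2 * A₀ * (2 ^ (k + 1) * ((k.factorial : ℝ) * Real.exp (δ / 2) * (2 / δ) ^ k) * Real.exp (δ / 2) * Zl D (δ / 2) ^ 2)
              + A₁ * (2 ^ (k + 1 + 1) * (((k + 1).factorial : ℝ) * Real.exp (δ / 2) * (2 / δ) ^ (k + 1)) * Real.exp (δ / 2) * Zl D (δ / 2) ^ 2)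
              + A₂ * (2 ^ (k + 2 + 1) * (((k + 2).factorial : ℝ) * Real.exp (δ / 2) * (2 / δ) ^ (k + 2)) * Real.exp (δ / 2) * Zl D (δ / 2) ^ 2))
            / (ρ : ℝ) ^ k) := by
  have hC := nonneg_of_loc hc
  have hA0 : 0 ≤ A₀ := (abs_nonneg _).trans (hA z)
  have hρ' : (0 : ℝ) < ρ := by exact_mod_cast hρ
  have hsm := summable_smear hδ hc hA z
  have hw := summable_weight hδ hc
  have hfm := fun i => summable_firstMoment hδ hc i
  have hsM := fun i j => summable_secondMoment hδ hc i j
  -- centred form: the Taylor remainder of order two at displacement `s`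
  set G : Site D → ℝ := fun s => F (z + s) - F z - ∑ i, (s i : ℝ) * Δ_[(Pi.single i 1 : Site D)] F z
      + (1 / 2) * ∑ i, (s i : ℝ) * Δ_[(Pi.single i 1 : Site D)] (Δ_[(Pi.single i 1 : Site D)] F) z
      - (1 / 2) * ∑ i, ∑ j, (s i : ℝ) * (s j : ℝ) * Δ_[(Pi.single i 1 : Site D)] (Δ_[(Pi.single j 1 : Site D)] F) z with hG
  have hlin : Summable fun p : Site D × Site D => ∑ i, c p * ((p.1 - p.2) i : ℝ)
      * (Δ_[(Pi.single i 1 : Site D)] F z - (1 / 2) * Δ_[(Pi.single i 1 : Site D)] (Δ_[(Pi.single i 1 : Site D)] F) z) :=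
    summable_sum fun i _ => (hfm i).mul_right _
  have hquad : Summable fun p : Site D × Site D => (1 / 2) * ∑ i, ∑ j, c p * ((((p.1 - p.2) i : ℤ) : ℝ) * (((p.1 - p.2) j : ℤ) : ℝ))
      * Δ_[(Pi.single i 1 : Site D)] (Δ_[(Pi.single j 1 : Site D)] F) z :=
    (summable_sum fun i _ => summable_sum fun j _ => (hsM i j).mul_right _).mul_left _
  have e : ∑' p : Site D × Site D, c p * F (z + p.1 - p.2) - (∑' p : Site D × Site D, c p) * F z
        - ∑ i, (∑' p : Site D × Site D, c p * ((p.1 - p.2) i : ℝ))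
            * (Δ_[(Pi.single i 1 : Site D)] F z - (1 / 2) * Δ_[(Pi.single i 1 : Site D)] (Δ_[(Pi.single i 1 : Site D)] F) z)
        - (1 / 2) * ∑ i, ∑ j, (∑' p : Site D × Site D, c p * ((((p.1 - p.2) i : ℤ) : ℝ) * (((p.1 - p.2) j : ℤ) : ℝ)))
            * Δ_[(Pi.single i 1 : Site D)] (Δ_[(Pi.single j 1 : Site D)] F) z
      = ∑' p : Site D × Site D, c p * G (p.1 - p.2) := by
    have e3 : ∑ i, (∑' p : Site D × Site D, c p * ((p.1 - p.2) i : ℝ))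
          * (Δ_[(Pi.single i 1 : Site D)] F z - (1 / 2) * Δ_[(Pi.single i 1 : Site D)] (Δ_[(Pi.single i 1 : Site D)] F) z)
        = ∑' p : Site D × Site D, ∑ i, c p * ((p.1 - p.2) i : ℝ)
            * (Δ_[(Pi.single i 1 : Site D)] F z - (1 / 2) * Δ_[(Pi.single i 1 : Site D)] (Δ_[(Pi.single i 1 : Site D)] F) z) := by
      rw [Summable.tsum_finsetSum (fun i _ => (hfm i).mul_right _)]
      refine Finset.sum_congr rfl fun i _ => ?_
      rw [← tsum_mul_right]
    have e4 : (1 / 2) * ∑ i, ∑ j, (∑' p : Site D × Site D, c p * ((((p.1 - p.2) i : ℤ) : ℝ) * (((p.1 - p.2) j : ℤ) : ℝ)))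
            * Δ_[(Pi.single i 1 : Site D)] (Δ_[(Pi.single j 1 : Site D)] F) z
        = ∑' p : Site D × Site D, (1 / 2) * ∑ i, ∑ j, c p * ((((p.1 - p.2) i : ℤ) : ℝ) * (((p.1 - p.2) j : ℤ) : ℝ))
            * Δ_[(Pi.single i 1 : Site D)] (Δ_[(Pi.single j 1 : Site D)] F) z := by
      rw [tsum_mul_left, Summable.tsum_finsetSum (fun i _ => summable_sum fun j _ => (hsM i j).mul_right _)]
      congr 1
      refine Finset.sum_congr rfl fun i _ => ?_
      rw [Summable.tsum_finsetSum (fun j _ => (hsM i j).mul_right _)]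
      refine Finset.sum_congr rfl fun j _ => ?_
      rw [← tsum_mul_right]
    rw [e3, e4, ← tsum_mul_right, ← hsm.tsum_sub (hw.mul_right (F z)), ← Summable.tsum_sub (hsm.sub (hw.mul_right (F z))) hlin,
      ← Summable.tsum_sub ((hsm.sub (hw.mul_right (F z))).sub hlin) hquad]
    refine tsum_congr fun p => ?_
    simp only [hG]
    rw [show z + p.1 - p.2 = z + (p.1 - p.2) from add_sub_assoc z p.1 p.2]
    have e5 : ∑ i, c p * ((p.1 - p.2) i : ℝ)
          * (Δ_[(Pi.single i 1 : Site D)] F z - (1 / 2) * Δ_[(Pi.single i 1 : Site D)] (Δ_[(Pi.single i 1 : Site D)] F) z)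
        = c p * ∑ i, ((p.1 - p.2) i : ℝ) * Δ_[(Pi.single i 1 : Site D)] F z
          - c p * ((1 / 2) * ∑ i, ((p.1 - p.2) i : ℝ) * Δ_[(Pi.single i 1 : Site D)] (Δ_[(Pi.single i 1 : Site D)] F) z) := by
      rw [Finset.mul_sum, Finset.mul_sum, Finset.mul_sum, ← Finset.sum_sub_distrib]
      exact Finset.sum_congr rfl fun i _ => by ring
    have e6 : (1 / 2) * ∑ i, ∑ j, c p * ((((p.1 - p.2) i : ℤ) : ℝ) * (((p.1 - p.2) j : ℤ) : ℝ))
          * Δ_[(Pi.single i 1 : Site D)] (Δ_[(Pi.single j 1 : Site D)] F) z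
        = c p * ((1 / 2) * ∑ i, ∑ j, (((p.1 - p.2) i : ℤ) : ℝ) * (((p.1 - p.2) j : ℤ) : ℝ)
          * Δ_[(Pi.single i 1 : Site D)] (Δ_[(Pi.single j 1 : Site D)] F) z) := by
      rw [Finset.mul_sum, Finset.mul_sum, Finset.mul_sum]
      refine Finset.sum_congr rfl fun i _ => ?_
      rw [Finset.mul_sum, Finset.mul_sum, Finset.mul_sum]
      exact Finset.sum_congr rfl fun j _ => by ring
    rw [e5, e6]
    ring
  rw [e]
  -- the majorant
  set T3 : ℝ := ∑' p : Site D × Site D, |c p| * ((l1 p.1 + 1) + (l1 p.2 + 1)) ^ 3 with hT3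
  set Tk : ℝ := ∑' p : Site D × Site D, |c p| * ((l1 p.1 + 1) + (l1 p.2 + 1)) ^ k with hTk
  set Tk1 : ℝ := ∑' p : Site D × Site D, |c p| * ((l1 p.1 + 1) + (l1 p.2 + 1)) ^ (k + 1) with hTk1
  set Tk2 : ℝ := ∑' p : Site D × Site D, |c p| * ((l1 p.1 + 1) + (l1 p.2 + 1)) ^ (k + 2) with hTk2
  have HM : HasSum (fun p : Site D × Site D => (D : ℝ) * ((D : ℝ) + 1) ^ 2 * B * (|c p| * ((l1 p.1 + 1) + (l1 p.2 + 1)) ^ 3)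
      + (2 * A₀ / (ρ : ℝ) ^ k * (|c p| * ((l1 p.1 + 1) + (l1 p.2 + 1)) ^ k)
        + A₁ / (ρ : ℝ) ^ k * (|c p| * ((l1 p.1 + 1) + (l1 p.2 + 1)) ^ (k + 1))
        + A₂ / (ρ : ℝ) ^ k * (|c p| * ((l1 p.1 + 1) + (l1 p.2 + 1)) ^ (k + 2))))
      ((D : ℝ) * ((D : ℝ) + 1) ^ 2 * B * T3 + (2 * A₀ / (ρ : ℝ) ^ k * Tk + A₁ / (ρ : ℝ) ^ k * Tk1 + A₂ / (ρ : ℝ) ^ k * Tk2)) :=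
    ((summable_loc_mul_pow hδ hc 3).hasSum.mul_left _).add
      ((((summable_loc_mul_pow hδ hc k).hasSum.mul_left _).add ((summable_loc_mul_pow hδ hc (k + 1)).hasSum.mul_left _)).add
        ((summable_loc_mul_pow hδ hc (k + 2)).hasSum.mul_left _))
  have hbound : ‖∑' p : Site D × Site D, c p * G (p.1 - p.2)‖
      ≤ (D : ℝ) * ((D : ℝ) + 1) ^ 2 * B * T3 + (2 * A₀ / (ρ : ℝ) ^ k * Tk + A₁ / (ρ : ℝ) ^ k * Tk1 + A₂ / (ρ : ℝ) ^ k * Tk2) := by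
    refine tsum_of_norm_bounded HM (fun p => ?_)
    rw [Real.norm_eq_abs, abs_mul]
    have hL := l1_sub_le_letters p.1 p.2
    have hLnn : 0 ≤ l1 (p.1 - p.2) := l1_nonneg _
    have hd := abs_taylor2_le_near_far_pow hρ hB hA1nn hA2nn k hA hA1 hA2 hF3 (p.1 - p.2)
    set L : ℝ := (l1 p.1 + 1) + (l1 p.2 + 1) with hLdef
    have hLpos : 0 ≤ L := by rw [hLdef]; linarith [l1_nonneg p.1, l1_nonneg p.2]
    have hmono : (D : ℝ) * ((D : ℝ) + 1) ^ 2 * B * l1 (p.1 - p.2) ^ 3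
          + (2 * A₀ + A₁ * l1 (p.1 - p.2) + A₂ * l1 (p.1 - p.2) ^ 2) * (l1 (p.1 - p.2) / ρ) ^ k
        ≤ (D : ℝ) * ((D : ℝ) + 1) ^ 2 * B * L ^ 3 + (2 * A₀ + A₁ * L + A₂ * L ^ 2) * (L / ρ) ^ k := by
      refine add_le_add (mul_le_mul_of_nonneg_left (pow_le_pow_left₀ hLnn hL 3) (by positivity)) ?_
      refine mul_le_mul ?_ ?_ (by positivity) (by positivity)
      · nlinarith [mul_le_mul_of_nonneg_left hL hA1nn, pow_le_pow_left₀ hLnn hL 2]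
      · exact pow_le_pow_left₀ (div_nonneg hLnn hρ'.le) (div_le_div_of_nonneg_right hL hρ'.le) k
    have esplit : (2 * A₀ + A₁ * L + A₂ * L ^ 2) * (L / ρ) ^ k
        = 2 * A₀ / (ρ : ℝ) ^ k * L ^ k + A₁ / (ρ : ℝ) ^ k * L ^ (k + 1) + A₂ / (ρ : ℝ) ^ k * L ^ (k + 2) := by
      rw [div_pow, pow_succ, pow_add]; ring
    calc |c p| * |G (p.1 - p.2)| ≤ |c p| * ((D : ℝ) * ((D : ℝ) + 1) ^ 2 * B * L ^ 3 + (2 * A₀ + A₁ * L + A₂ * L ^ 2) * (L / ρ) ^ k) :=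
          mul_le_mul_of_nonneg_left (hd.trans hmono) (abs_nonneg _)
      _ = _ := by rw [esplit]; ring
  rw [Real.norm_eq_abs] at hbound
  refine hbound.trans ?_
  have h3 := tsum_loc_mul_pow_le hδ hc 3
  have hk := tsum_loc_mul_pow_le hδ hc k
  have hk1 := tsum_loc_mul_pow_le hδ hc (k + 1)
  have hk2 := tsum_loc_mul_pow_le hδ hc (k + 2)
  have : 0 ≤ 2 * A₀ / (ρ : ℝ) ^ k := by positivity
  have : 0 ≤ A₁ / (ρ : ℝ) ^ k := by positivity
  have : 0 ≤ A₂ / (ρ : ℝ) ^ k := by positivity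
  have : 0 ≤ (D : ℝ) * ((D : ℝ) + 1) ^ 2 * B := by positivity
  calc (D : ℝ) * ((D : ℝ) + 1) ^ 2 * B * T3 + (2 * A₀ / (ρ : ℝ) ^ k * Tk + A₁ / (ρ : ℝ) ^ k * Tk1 + A₂ / (ρ : ℝ) ^ k * Tk2)
      ≤ (D : ℝ) * ((D : ℝ) + 1) ^ 2 * B * (C * (2 ^ (3 + 1) * (((3 : ℕ).factorial : ℝ) * Real.exp (δ / 2) * (2 / δ) ^ 3) * Real.exp (δ / 2) * Zl D (δ / 2) ^ 2))
        + (2 * A₀ / (ρ : ℝ) ^ k * (C * (2 ^ (k + 1) * ((k.factorial : ℝ) * Real.exp (δ / 2) * (2 / δ) ^ k) * Real.exp (δ / 2) * Zl D (δ / 2) ^ 2))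
          + A₁ / (ρ : ℝ) ^ k * (C * (2 ^ (k + 1 + 1) * (((k + 1).factorial : ℝ) * Real.exp (δ / 2) * (2 / δ) ^ (k + 1)) * Real.exp (δ / 2) * Zl D (δ / 2) ^ 2))
          + A₂ / (ρ : ℝ) ^ k * (C * (2 ^ (k + 2 + 1) * (((k + 2).factorial : ℝ) * Real.exp (δ / 2) * (2 / δ) ^ (k + 2)) * Real.exp (δ / 2) * Zl D (δ / 2) ^ 2))) := by
        gcongr
    _ = _ := by ring

end Smear

end Summit.QuantumFields.BalabanUV.Beta.FP.ExpLocalisedBubbleOrder2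

end
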